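import Literature.MathematicalPhysics.QuantumFieldTheory.Balaban1983to89.B10Eq18SigmaEven
import Literature.Algebra.Lie.CompactKillingForm

/-!
# `Balaban1983to89.B10Eq18SigmaSU2` — T. Bałaban, *Ultraviolet stability of three-dimensional lattice pure gauge
# field theories*, Commun. Math. Phys. **102** (1985) 255–275 [Balaban1985UV3], p. 260, PRINT'S EXAMPLE
# «for SU(2) we have σ(A) = 1/2π² (sin|A|/|A|)², where |A|² = Σ_{a=1}^3 (A^a)², … A = Σ_{a=1}^3 σ_aA^a» —
# PROVED in the matrix dictionary `σ/σ₀ = σrel(T) = det φ(T)` of `B13HaarSigma` WITHOUT the eigenvalue dictionary: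
# the matrix of `−ad(iA)` on `𝔰𝔲(2)` in the Pauli coordinates is `T_A = 2[A]_×` (cross-product matrix), `T_A³ =
# −(2|A|)²T_A`, hence `φ(T_A) = 1 + a T_A + b T_A²` with the cosine/sine tails `a, b`, and `det = (sin|A|/|A|)²`
# (definitions `crossMatrix`, `pauli`, `su2Coord` + theorems)

statement-level skeleton of published theorems with citation tags; proofs where landed; nothing here is a claim
about the Yang–Mills mass gap

PDF held: `paper:balaban1985-cmp102-uv-stability-3d`; p. 260 [PDF 6] re-read by this seat from the x2 render
`pub-balaban/b2b-balaban-ref1/pages/1985-cmp102-uv-stability-3d/1985-cmp102-uv-stability-3d-p006-x2.png` (2026-08-22).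

WHAT IS REPRODUCED.  Mega-formalization `lit-balaban` (HOME `run/shared/lean/pub/lit-balaban/`), unit `lit-balaban-r07`
gen 17, file 3.  SKELETON rows: narrative display E18 of `lit-balaban-r07/ROWS-B10.md` §2 (row of record **B10.Eq21**
names the σ-sentence in its depends-on cell).  The audit module `B13HaarSigma` §3 (`su2_scalar_check`) verified the
SCALAR identity `φ(0)φ(2ir)φ(−2ir) = (sin r/r)²` and RECORDED as «not proved here» the dictionary «the eigenvalues of
`ad A` on `su(2)` are `0, ±2i|A|`» that turns it into the printed formula.  THIS FILE proves the printed formula at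
matrix level, replacing the eigenvalue dictionary by the cubic relation of the cross-product matrix:
§1 on ANY Banach algebra, `k³ = c·k ⇒ φ(k) = 1 + a k + b k²` with `a = Σ_m c^m/(2m+2)!`, `b = Σ_m c^m/(2m+3)!`
(`phi_eq_of_cube`, from `B13HaarSigma.hasSum_phi_sub_one` split into even/odd parts), and for `c = −θ²`, `θ ≠ 0`:
`a = (1 − cos θ)/θ²`, `b = (θ − sin θ)/θ³` (`hasSum_a`, `hasSum_b`, the shifted Mathlib cosine/sine series);
§2 the cross-product matrix `[c]_×` (`crossMatrix`, `[c]_× v = c ×₃ v` = Mathlib's `crossProduct`): `[c]_׳ = −|c|²[c]_×`,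
`tr [c]_× = 0`, `[c]_ײ = c cᵀ − |c|²·1`, and `det(1 + a[c]_× + b[c]_ײ) = (1 − b|c|²)² + a²|c|²` (brute force in
`Fin 3`, any commutative ring); §3 for `T_A = 2[A]_×` (cast to `ℂ`), `A·A = r²`, `r ≠ 0`:
**`σrel(T_A) = (sin r/r)²`** (`sigmaRel_two_smul_crossMatrix`; the double-angle bookkeeping
`(sin 2r/2r)² + ((1 − cos 2r)/2r)² = (sin r/r)²`); §4 the Pauli matrices (`pauli`) and the Pauli coordinates
`X(x) = i Σ_a x_aσ_a` of `𝔰𝔲(2)` (`su2Coord`; `su2Coord_eq_sum`) with the structure constants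
**`[X(x), X(y)] = X(−2 x × y)`** (`su2Coord_commutator`, from `[σ_a, σ_b] = 2iε_{abc}σ_c`); §5 the dictionary closed:
`X(x) ∈ 𝔰𝔲(2)` (the tree's `Literature.Algebra.Lie.CompactKillingForm.su (Fin 2)`), `X` injective and onto `𝔰𝔲(2)`
(`su2Coord_mem_su`, `su2Coord_injective`, `exists_su2Coord_eq`), **`ad(X(x)) X(y) = X(−2[x]_× y)`** for
`B13HaarSigma.adMat` (`adMat_su2Coord`) — so `T_A = 2[A]_×` IS the matrix of `−ad(iA)` in print's coordinates `A^a` — and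
**`sigmaRel_su2`: for `A ≠ 0`, `σrel(T_A) = (sin|A|/|A|)²`, `|A| = √(Σ (A^a)²)`**; `sigmaRel_su2_zero` (`= 1` at `A = 0`),
`sigmaRel_su2_even` (file 1's evenness at the example, `tr T_A = 0`).

THE PRINTED TEXT.  p. 260 (verbatim, render p006-x2): *"… σ(A′) is a density which can be calculated explicitly for all
classical groups. For example for SU(2) we have σ(A) = 1/2π² (sin|A|/|A|)², where |A| = Σ_{a=1}^{3} (A^a)² [sic: the
square root is not printed], and an element A of the Lie algebra is represented as A = Σ_{a=1}^{3} σ_aA^a, σ_a are the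
three Pauli matrices (generators of the Lie algebra)."*  The group element is written `exp iA` ((18): `exp i(A − D̃(A))U₁`),
so the `𝔰𝔲(2)` element is `iA = X(A)`; [Hel] = [Helgason2000] Ch. I §1 Thm. 1.14 (12) p. 96: `σ(X)/σ₀ = det((1 − e^{−adX})/adX)
= det φ(−ad X)`.

HONEST SCOPE.  (i) As in `B13HaarSigma` and file 1, the identification of `det φ(−ad X)` with the Haar density ([Hel]
Thm. 1.14) is quoted, not formalised, and the NORMALISATION `σ₀ = 1/2π²` (the total Haar mass of `SU(2)` in these
coordinates) is not computed: what is proved is `σ(A)/σ₀ = (sin|A|/|A|)²` in the dictionary.  (ii) `T_A` is the matrix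
of `−ad(iA)` with respect to the coordinate system `X` (`adMat_su2Coord` + `exists_su2Coord_eq`/`su2Coord_injective`);
no `Module.Basis` object of the subtype `↥(su (Fin 2))` is built.  (iii) The multiplicities of the eigenvalues `0, ±2i|A|`
are not discussed (not needed: the cubic relation replaces the spectral argument); p28's `AdEigenvalues` (the general
eigenvalue dictionary `σ(ad X) = σ(X) − σ(X)`) is independent of this file.  3 definitions (`crossMatrix`, `pauli`,
`su2Coord`: plumbing for print's «σ_a» and «A^a»), 0 new named facts.
-/

noncomputable section

open NormedSpace Filter
open scoped Nat Topology

namespace Literature.MathematicalPhysics.QuantumFieldTheory.Balaban1983to89.B10Eq18SigmaSU2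

open B13HaarSigma B10Eq18SigmaEven

/-! ## §1  `φ` on an element with `k³ = −θ² k` -/

section Cube

variable {𝔸 : Type*} [NormedRing 𝔸] [NormedAlgebra ℂ 𝔸] [CompleteSpace 𝔸]

omit [CompleteSpace 𝔸] in
/-- Odd powers under `k³ = c k`: `k^{2m+1} = c^m k`. [folklore] -/
private theorem pow_odd_of_cube {k : 𝔸} {c : ℂ} (hk : k ^ 3 = c • k) (m : ℕ) : k ^ (2 * m + 1) = c ^ m • k := by
  induction m with
  | zero => simp
  | succ m ih =>
    rw [show 2 * (m + 1) + 1 = 2 * m + 1 + 2 by ring, pow_add, ih, smul_mul_assoc, ← pow_succ' k 2, hk,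
      smul_smul, ← pow_succ]

omit [CompleteSpace 𝔸] in
/-- Even powers under `k³ = c k`: `k^{2m+2} = c^m k²`. [folklore] -/
private theorem pow_even_of_cube {k : 𝔸} {c : ℂ} (hk : k ^ 3 = c • k) (m : ℕ) : k ^ (2 * m + 2) = c ^ m • k ^ 2 := by
  rw [pow_succ, pow_odd_of_cube hk m, smul_mul_assoc, ← pow_two]

/-- **`φ(k) = 1 + a k + b k²` when `k³ = c k`**, with `a = Σ_m c^m/(2m+2)!`, `b = Σ_m c^m/(2m+3)!` — the series
`φ(z) = (e^z − 1)/z` of [Hel] (12) evaluated on an element with a cubic relation (for `ad` on `𝔰𝔲(2)`, `c = −(2|A|)²`).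
[cite: Helgason2000, Ch. I §1 Thm. 1.14 (12) p. 96] [cite: Balaban1985UV3, p. 260] -/
theorem phi_eq_of_cube {k : 𝔸} {c : ℂ} (hk : k ^ 3 = c • k) {a b : ℂ}
    (ha : HasSum (fun m : ℕ => ((2 * m + 2)! : ℂ)⁻¹ * c ^ m) a)
    (hb : HasSum (fun m : ℕ => ((2 * m + 3)! : ℂ)⁻¹ * c ^ m) b) :
    phi k = 1 + a • k + b • k ^ 2 := by
  -- g n := phiCoeff (n+1) • k^(n+1) sums to φ(k) − 1
  have hg := hasSum_phi_sub_one k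
  have he : HasSum (fun m : ℕ => phiCoeff (2 * m + 1) • k ^ (2 * m + 1)) (a • k) := by
    have := ha.smul_const k
    refine this.congr_fun ?_
    intro m
    rw [pow_odd_of_cube hk, smul_smul, phiCoeff, show 2 * m + 1 + 1 = 2 * m + 2 by ring]
  have ho : HasSum (fun m : ℕ => phiCoeff (2 * m + 1 + 1) • k ^ (2 * m + 1 + 1)) (b • k ^ 2) := by
    have := hb.smul_const (k ^ 2)
    refine this.congr_fun ?_
    intro m
    rw [show 2 * m + 1 + 1 = 2 * m + 2 by ring, pow_even_of_cube hk, smul_smul, phiCoeff,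
      show 2 * m + 2 + 1 = 2 * m + 3 by ring]
  have h := HasSum.even_add_odd (f := fun n => phiCoeff (n + 1) • k ^ (n + 1)) he ho
  have := hg.unique h
  rw [sub_eq_iff_eq_add'] at this
  rw [this, add_assoc]

/-- `Σ_m (−θ²)^m/(2m+2)! = (1 − cos θ)/θ²` for `θ ≠ 0` (shifted cosine series; the coefficient `a` of `φ` on `𝔰𝔲(2)`).
[cite: Helgason2000, Ch. I §1 Thm. 1.14 (12) p. 96] [cite: Balaban1985UV3, p. 260] -/
theorem hasSum_a {θ : ℝ} (hθ : θ ≠ 0) :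
    HasSum (fun m : ℕ => ((2 * m + 2)! : ℂ)⁻¹ * (-(θ : ℂ) ^ 2) ^ m) ((1 - Complex.cos θ) / θ ^ 2) := by
  have hθ' : (θ : ℂ) ≠ 0 := Complex.ofReal_ne_zero.mpr hθ
  have hθ2 : (-(θ : ℂ) ^ 2) ≠ 0 := neg_ne_zero.mpr (pow_ne_zero 2 hθ')
  have h1 := (hasSum_nat_add_iff' 1).mpr (Complex.hasSum_cos θ)
  simp only [Finset.sum_range_one, pow_zero, mul_zero, Nat.factorial_zero, Nat.cast_one, div_one,
    mul_one] at h1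
  have h2 := h1.div_const (-(θ : ℂ) ^ 2)
  have key : ∀ m : ℕ, (-1) ^ (m + 1) * (θ : ℂ) ^ (2 * (m + 1)) / ((2 * (m + 1))! : ℂ) / (-(θ : ℂ) ^ 2) =
      ((2 * m + 2)! : ℂ)⁻¹ * (-(θ : ℂ) ^ 2) ^ m := by
    intro m
    rw [show 2 * (m + 1) = 2 * m + 2 by ring, div_eq_iff hθ2, div_eq_mul_inv, neg_pow, pow_succ,
      show (θ : ℂ) ^ (2 * m + 2) = ((θ : ℂ) ^ 2) ^ m * (θ : ℂ) ^ 2 by rw [← pow_mul, ← pow_add]]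
    ring
  simp only [key] at h2
  rwa [div_neg, ← neg_div, neg_sub] at h2

/-- `Σ_m (−θ²)^m/(2m+3)! = (θ − sin θ)/θ³` for `θ ≠ 0` (shifted sine series; the coefficient `b` of `φ` on `𝔰𝔲(2)`).
[cite: Helgason2000, Ch. I §1 Thm. 1.14 (12) p. 96] [cite: Balaban1985UV3, p. 260] -/
theorem hasSum_b {θ : ℝ} (hθ : θ ≠ 0) :
    HasSum (fun m : ℕ => ((2 * m + 3)! : ℂ)⁻¹ * (-(θ : ℂ) ^ 2) ^ m) ((θ - Complex.sin θ) / θ ^ 3) := by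
  have hθ' : (θ : ℂ) ≠ 0 := Complex.ofReal_ne_zero.mpr hθ
  have hθ3 : (-(θ : ℂ) ^ 3) ≠ 0 := neg_ne_zero.mpr (pow_ne_zero 3 hθ')
  have h1 := (hasSum_nat_add_iff' 1).mpr (Complex.hasSum_sin θ)
  simp only [Finset.sum_range_one, pow_zero, mul_zero, zero_add, pow_one, Nat.factorial_one, Nat.cast_one,
    div_one, one_mul] at h1
  have h2 := h1.div_const (-(θ : ℂ) ^ 3)
  have key : ∀ m : ℕ, (-1) ^ (m + 1) * (θ : ℂ) ^ (2 * (m + 1) + 1) / ((2 * (m + 1) + 1)! : ℂ) / (-(θ : ℂ) ^ 3) =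
      ((2 * m + 3)! : ℂ)⁻¹ * (-(θ : ℂ) ^ 2) ^ m := by
    intro m
    rw [show 2 * (m + 1) + 1 = 2 * m + 3 by ring, div_eq_iff hθ3, div_eq_mul_inv, neg_pow, pow_succ,
      show (θ : ℂ) ^ (2 * m + 3) = ((θ : ℂ) ^ 2) ^ m * (θ : ℂ) ^ 3 by rw [← pow_mul, ← pow_add]]
    ring
  simp only [key] at h2
  rwa [div_neg, ← neg_div, neg_sub] at h2

end Cube

/-! ## §2  The cross-product matrix `[c]_×`: `[c]_׳ = −|c|²[c]_×`, `tr [c]_× = 0`, `det(1 + a[c]_× + b[c]_ײ)` -/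

section Cross

variable {R : Type*} [CommRing R]

/-- The cross-product matrix of `c ∈ R³`: `[c]_× v = c × v` — the matrix of `ad` on `𝔰𝔲(2) ≅ (ℝ³, ×)` up to the factor
`−2` of the Pauli coordinates (`adMat_su2Coord`). [cite: Balaban1985UV3, p. 260] -/
def crossMatrix (c : Fin 3 → R) : Matrix (Fin 3) (Fin 3) R :=
  !![0, -c 2, c 1; c 2, 0, -c 0; -c 1, c 0, 0]

/-- `[c]_× v = c ×₃ v` (Mathlib's `crossProduct`). [cite: Balaban1985UV3, p. 260] -/
theorem crossMatrix_mulVec (c v : Fin 3 → R) : (crossMatrix c).mulVec v = crossProduct c v := by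
  ext i
  fin_cases i <;> simp [crossMatrix, Matrix.mulVec, dotProduct, Fin.sum_univ_three, cross_apply] <;> ring

/-- `tr [c]_× = 0` (the evenness hypothesis of file 1 at the example). [cite: Balaban1985UV3, p. 260] -/
theorem trace_crossMatrix (c : Fin 3 → R) : (crossMatrix c).trace = 0 := by
  simp [crossMatrix, Matrix.trace, Fin.sum_univ_three]

/-- `[−c]_× = −[c]_×`. [cite: Balaban1985UV3, p. 260] -/
theorem crossMatrix_neg (c : Fin 3 → R) : crossMatrix (-c) = -crossMatrix c := by
  ext i j
  fin_cases i <;> fin_cases j <;> simp [crossMatrix]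

/-- `[c]_ײ = c cᵀ − |c|²·1`. [cite: Balaban1985UV3, p. 260] -/
theorem crossMatrix_sq (c : Fin 3 → R) :
    crossMatrix c ^ 2 = Matrix.of (fun i j => c i * c j) - dotProduct c c • (1 : Matrix (Fin 3) (Fin 3) R) := by
  ext i j
  fin_cases i <;> fin_cases j <;>
    simp [crossMatrix, pow_two, Matrix.mul_apply, Fin.sum_univ_three, dotProduct] <;> ring

/-- **The cubic relation `[c]_׳ = −|c|²[c]_×`** (replacing the eigenvalue dictionary `0, ±i|c|`). [cite: Balaban1985UV3, p. 260] -/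
theorem crossMatrix_pow_three (c : Fin 3 → R) :
    crossMatrix c ^ 3 = (-dotProduct c c) • crossMatrix c := by
  ext i j
  fin_cases i <;> fin_cases j <;>
    simp [crossMatrix, pow_succ, Matrix.mul_apply, Fin.sum_univ_three, dotProduct] <;> ring

/-- **`det(1 + a[c]_× + b[c]_ײ) = (1 − b|c|²)² + a²|c|²`** (= `(1 + aiθ − bθ²)(1 − aiθ − bθ²)`, `θ = |c|`).
[cite: Balaban1985UV3, p. 260] -/
theorem det_one_add_crossMatrix (c : Fin 3 → R) (a b : R) :
    (1 + a • crossMatrix c + b • crossMatrix c ^ 2).det =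
      (1 - b * dotProduct c c) ^ 2 + a ^ 2 * dotProduct c c := by
  rw [crossMatrix_sq]
  simp [Matrix.det_fin_three, crossMatrix, dotProduct, Fin.sum_univ_three]
  ring

end Cross

/-! ## §4  The Pauli coordinates of `𝔰𝔲(2)`: `ad(iA)` acts as `−2[A]_×` -/

section Pauli

open Complex

/-- `(aI)(bI) = −ab`. [folklore] -/
private theorem mulI_mulI (a b : ℂ) : a * I * (b * I) = -(a * b) := by
  rw [mul_mul_mul_comm, Complex.I_mul_I]; ring

/-- `(aI)I = −a`. [folklore] -/
private theorem mulI_I (a : ℂ) : a * I * I = -a := by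
  rw [mul_assoc, Complex.I_mul_I]; ring

/-- The Pauli matrices `σ₁, σ₂, σ₃` («the three Pauli matrices (generators of the Lie algebra)», p. 260).
[cite: Balaban1985UV3, p. 260] -/
def pauli : Fin 3 → Matrix (Fin 2) (Fin 2) ℂ :=
  ![!![0, 1; 1, 0], !![0, -I; I, 0], !![1, 0; 0, -1]]

/-- The Pauli coordinates of `𝔰𝔲(2)`: `X(x) = i Σ_a x_a σ_a` — print's «A = Σ_{a=1}^3 σ_aA^a» times `i` (the group
element is `exp iA`). [cite: Balaban1985UV3, p. 260] -/
def su2Coord (x : Fin 3 → ℝ) : Matrix (Fin 2) (Fin 2) ℂ :=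
  !![(x 2 : ℂ) * I, (x 0 : ℂ) * I + x 1; (x 0 : ℂ) * I - x 1, -((x 2 : ℂ) * I)]

/-- `X(x) = i(x₁σ₁ + x₂σ₂ + x₃σ₃)`. [cite: Balaban1985UV3, p. 260] -/
theorem su2Coord_eq_sum (x : Fin 3 → ℝ) : su2Coord x = ∑ a, ((x a : ℂ) * I) • pauli a := by
  ext i j
  fin_cases i <;> fin_cases j <;> simp [su2Coord, pauli, Fin.sum_univ_three, mulI_I]
  all_goals ring

/-- **The structure constants of `𝔰𝔲(2)` in Pauli coordinates: `[X(x), X(y)] = X(−2 x × y)`** (from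
`[σ_a, σ_b] = 2i ε_{abc} σ_c`), i.e. `ad(X(x))` acts on coordinates as `−2[x]_×`. [cite: Balaban1985UV3, p. 260] -/
theorem su2Coord_commutator (x y : Fin 3 → ℝ) :
    su2Coord x * su2Coord y - su2Coord y * su2Coord x = su2Coord ((-2 : ℝ) • (crossMatrix x).mulVec y) := by
  rw [crossMatrix_mulVec]
  ext i j
  fin_cases i <;> fin_cases j <;>
    simp [su2Coord, cross_apply, mul_add, add_mul, mul_sub, sub_mul, mulI_mulI]
  all_goals ring

end Pauli

/-! ## §3  Print's example: `σ(A)/σ₀ = (sin|A|/|A|)²` for the matrix `T_A = 2[A]_×` of `−ad(iA)` on `𝔰𝔲(2)` -/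

section Formula

open Matrix
open scoped Matrix.Norms.Operator

/-- Entrywise cast of `2[A]_×`. [folklore] -/
private theorem map_two_smul_crossMatrix (A : Fin 3 → ℝ) :
    ((2 : ℝ) • crossMatrix A).map (algebraMap ℝ ℂ) = (2 : ℂ) • crossMatrix (fun i => (A i : ℂ)) := by
  ext i j
  fin_cases i <;> fin_cases j <;> simp [crossMatrix]

/-- `|A|²` cast: `Σ A_i² = r²` in `ℂ`. [folklore] -/
private theorem dotProduct_cast {A : Fin 3 → ℝ} {r : ℝ} (hA : dotProduct A A = r ^ 2) :
    dotProduct (fun i => (A i : ℂ)) (fun i => (A i : ℂ)) = (r : ℂ) ^ 2 := by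
  have h := congrArg (fun t : ℝ => (t : ℂ)) hA
  simpa [dotProduct, Fin.sum_univ_three] using h

/-- The double-angle bookkeeping: `(sin 2r/2r)² + ((1 − cos 2r)/2r)² = (sin r/r)²`, in the shape produced by
`φ(k) = 1 + a k + b k²`. [folklore] -/
private theorem trig_identity {r : ℂ} (hr : r ≠ 0) :
    (1 - (2 * r - Complex.sin (2 * r)) / (2 * r) ^ 3 * 2 ^ 2 * r ^ 2) ^ 2 +
        ((1 - Complex.cos (2 * r)) / (2 * r) ^ 2 * 2) ^ 2 * r ^ 2 =
      (Complex.sin r / r) ^ 2 := by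
  have h := Complex.sin_sq_add_cos_sq r
  have e1 : 1 - (2 * r - Complex.sin (2 * r)) / (2 * r) ^ 3 * 2 ^ 2 * r ^ 2 =
      Complex.sin r * Complex.cos r / r := by
    rw [Complex.sin_two_mul]
    field_simp
    ring
  have e2 : ((1 - Complex.cos (2 * r)) / (2 * r) ^ 2 * 2) ^ 2 * r ^ 2 = (Complex.sin r ^ 2 / r) ^ 2 := by
    rw [Complex.cos_two_mul, Complex.cos_sq']
    field_simp
    ring
  rw [e1, e2, div_pow, div_pow, div_pow, ← add_div]
  congr 1
  linear_combination (Complex.sin r) ^ 2 * h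

set_option backward.isDefEq.respectTransparency false in
/-- **`σrel(2[A]_×) = (sin r/r)²` for `A·A = r²`, `r ≠ 0`** — the printed `σ(A)/σ₀` for `SU(2)` in the `B13HaarSigma`
dictionary, from the cubic relation and the cosine/sine tails (no eigenvalues). [cite: Balaban1985UV3, p. 260]
[cite: Helgason2000, Ch. I §1 Thm. 1.14 (12) p. 96] -/
theorem sigmaRel_two_smul_crossMatrix {A : Fin 3 → ℝ} {r : ℝ} (hr : r ≠ 0) (hA : dotProduct A A = r ^ 2) :
    sigmaRel (((2 : ℝ) • crossMatrix A).map (algebraMap ℝ ℂ)) = (((Real.sin r / r) ^ 2 : ℝ) : ℂ) := by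
  have hdot := dotProduct_cast hA
  have hk : ((2 : ℂ) • crossMatrix (fun i => (A i : ℂ))) ^ 3 =
      (-(((2 * r : ℝ) : ℂ)) ^ 2) • ((2 : ℂ) • crossMatrix (fun i => (A i : ℂ))) := by
    rw [smul_pow, crossMatrix_pow_three, hdot, smul_smul, smul_smul]
    push_cast
    ring_nf
  have hθ : 2 * r ≠ 0 := mul_ne_zero two_ne_zero hr
  have hphi := phi_eq_of_cube hk (hasSum_a hθ) (hasSum_b hθ)
  rw [sigmaRel, map_two_smul_crossMatrix, hphi, smul_pow, smul_smul, smul_smul, det_one_add_crossMatrix, hdot]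
  push_cast
  exact trig_identity (Complex.ofReal_ne_zero.mpr hr)

end Formula

/-! ## §5  The dictionary closed: `X : ℝ³ ≅ 𝔰𝔲(2)`, `ad(iA) = −2[A]_×` in Pauli coordinates, and the printed formula -/

section Dictionary

open Complex Matrix
open scoped Matrix.Norms.Operator
open Literature.Algebra.Lie.CompactKillingForm (su mem_su_iff)

/-- `X(x)` is traceless and skew-Hermitian: `X(x) ∈ 𝔰𝔲(2)` (the tree's `CompactKillingForm.su (Fin 2)`).
[cite: Balaban1985UV3, p. 260] -/
theorem su2Coord_mem_su (x : Fin 3 → ℝ) : su2Coord x ∈ su (Fin 2) := by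
  rw [mem_su_iff]
  constructor
  · ext i j
    fin_cases i <;> fin_cases j <;> simp [su2Coord, Matrix.conjTranspose_apply, Complex.ext_iff]
  · simp [su2Coord, Matrix.trace, Fin.sum_univ_two]

/-- `X` is injective (the coordinates `A^a` are determined by `iA`). [cite: Balaban1985UV3, p. 260] -/
theorem su2Coord_injective : Function.Injective su2Coord := by
  intro x y h
  have h00 := congr_fun (congr_fun h 0) 0
  have h01 := congr_fun (congr_fun h 0) 1
  simp only [su2Coord, Matrix.of_apply, Matrix.cons_val', Matrix.cons_val_zero, Matrix.cons_val_one,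
    Matrix.empty_val', Matrix.cons_val_fin_one, Complex.ext_iff] at h00 h01
  simp at h00 h01
  funext a
  fin_cases a
  · exact h01.2
  · exact h01.1
  · exact h00

/-- `X` is onto `𝔰𝔲(2)`: every traceless skew-Hermitian `2 × 2` matrix is `i Σ x_a σ_a` with real `x_a` — so
`x ↦ X(x)` is a (real-linear) coordinate system of `𝔰𝔲(2)`, print's «A = Σ σ_aA^a». [cite: Balaban1985UV3, p. 260] -/
theorem exists_su2Coord_eq {S : Matrix (Fin 2) (Fin 2) ℂ} (hS : S ∈ su (Fin 2)) : ∃ x : Fin 3 → ℝ, su2Coord x = S := by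
  rw [mem_su_iff] at hS
  obtain ⟨hH, htr⟩ := hS
  have e00 := congr_fun (congr_fun hH 0) 0
  have e01 := congr_fun (congr_fun hH 0) 1
  have e11 := congr_fun (congr_fun hH 1) 1
  simp only [Matrix.conjTranspose_apply, Matrix.neg_apply, Complex.ext_iff, Complex.star_def, Complex.conj_re,
    Complex.conj_im, Complex.neg_re, Complex.neg_im] at e00 e01 e11
  simp only [Matrix.trace, Matrix.diag, Fin.sum_univ_two, Complex.ext_iff, Complex.add_re, Complex.add_im,
    Complex.zero_re, Complex.zero_im] at htr
  refine ⟨![(S 0 1).im, (S 0 1).re, (S 0 0).im], ?_⟩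
  ext i j
  fin_cases i <;> fin_cases j <;> simp [su2Coord, Complex.ext_iff]
  · linarith [e00.1]
  · constructor <;> linarith [e01.1, e01.2]
  · constructor <;> linarith [e00.1, htr.1, htr.2]

/-- **THE DICTIONARY `ad(iA) = −2[A]_×`**: in Pauli coordinates the adjoint action of `X(x) = i Σ x_aσ_a` on `𝔰𝔲(2)` is
`−2 ×` the cross-product matrix: `ad(X(x))(X(y)) = X(−2 [x]_× y)` (`B13HaarSigma.adMat`) — hence the matrix of
`−ad(iA)` in the coordinates `A^a` is `T_A = 2[A]_×`, whose complex eigenvalues are `0, ±2i|A|` (the dictionary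
RECORDED as unproved in `B13HaarSigma` §3, here replaced by the relation `T_A³ = −(2|A|)²T_A`). [cite: Balaban1985UV3, p. 260] -/
theorem adMat_su2Coord (x y : Fin 3 → ℝ) :
    adMat (su2Coord x) (su2Coord y) = su2Coord ((-2 : ℝ) • (crossMatrix x).mulVec y) := by
  rw [adMat_apply, su2Coord_commutator]

/-- `T_A = 2[A]_×` is traceless (so file 1's `sigmaRel_map_neg_of_trace_eq_zero` applies: `σ` is even in `A`).
[cite: Balaban1985UV3, p. 260] -/
theorem trace_two_smul_crossMatrix (A : Fin 3 → ℝ) : ((2 : ℝ) • crossMatrix A).trace = 0 := by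
  rw [Matrix.trace_smul, trace_crossMatrix, smul_zero]

/-- **PRINT'S EXAMPLE, KERNEL FORM: «for SU(2) we have σ(A) = 1/2π² (sin|A|/|A|)², where |A|² = Σ_{a=1}^3 (A^a)²»** —
in the dictionary `σ(A)/σ₀ = det φ(T_A)` of `B13HaarSigma` with `T_A = 2[A]_×` the matrix of `−ad(iA)` in the Pauli
coordinates (`adMat_su2Coord`): for `A ≠ 0`, `σrel(T_A) = (sin|A|/|A|)²` with `|A| = √(Σ (A^a)²)`; the normalisation
`σ₀ = 1/2π²` (total Haar mass) is not computed here. [cite: Balaban1985UV3, p. 260] -/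
theorem sigmaRel_su2 {A : Fin 3 → ℝ} (hA : A ≠ 0) :
    sigmaRel (((2 : ℝ) • crossMatrix A).map (algebraMap ℝ ℂ)) =
      (((Real.sin (Real.sqrt (dotProduct A A)) / Real.sqrt (dotProduct A A)) ^ 2 : ℝ) : ℂ) := by
  have hpos : 0 < dotProduct A A := by
    rw [dotProduct, Fin.sum_univ_three]
    have h : A 0 ≠ 0 ∨ A 1 ≠ 0 ∨ A 2 ≠ 0 := by
      by_contra hc
      push Not at hc
      apply hA
      funext i
      fin_cases i
      · exact hc.1
      · exact hc.2.1
      · exact hc.2.2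
    rcases h with h | h | h <;> nlinarith [sq_nonneg (A 0), sq_nonneg (A 1), sq_nonneg (A 2), sq_pos_of_ne_zero h]
  have hr : Real.sqrt (dotProduct A A) ≠ 0 := (Real.sqrt_pos.mpr hpos).ne'
  exact sigmaRel_two_smul_crossMatrix hr (Real.sq_sqrt hpos.le).symm

/-- At `A = 0`: `σ(0)/σ₀ = 1` (`T_0 = 0`, `B13HaarSigma.sigmaRel_zero`). [cite: Balaban1985UV3, p. 260] -/
theorem sigmaRel_su2_zero : sigmaRel (((2 : ℝ) • crossMatrix (0 : Fin 3 → ℝ)).map (algebraMap ℝ ℂ)) = 1 := by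
  have h : ((2 : ℝ) • crossMatrix (0 : Fin 3 → ℝ)).map (algebraMap ℝ ℂ) = 0 := by
    ext i j
    fin_cases i <;> fin_cases j <;> simp [crossMatrix]
  rw [h, sigmaRel_zero]

/-- «σ(A) is … even» at the example: `σrel(−T_A) = σrel(T_A)` by file 1 (`tr T_A = 0`), consistent with the closed
form depending on `|A|` only. [cite: Balaban1985UV3, p. 260] -/
theorem sigmaRel_su2_even (A : Fin 3 → ℝ) :
    sigmaRel ((-((2 : ℝ) • crossMatrix A)).map (algebraMap ℝ ℂ)) = sigmaRel (((2 : ℝ) • crossMatrix A).map (algebraMap ℝ ℂ)) :=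
  sigmaRel_map_neg_of_trace_eq_zero (trace_two_smul_crossMatrix A)

end Dictionary

end Literature.MathematicalPhysics.QuantumFieldTheory.Balaban1983to89.B10Eq18SigmaSU2
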